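import Literature.RingTheory.CentralSimple.MulLeftRight
import Mathlib.RingTheory.TensorProduct.Basic
import Mathlib.RingTheory.TensorProduct.Free
import HarnessLib

/-!
# Base change of a central simple algebra to a field extension is simple

For a finite-dimensional central simple algebra `D` over a field `K` and a field `L ⊇ K`
(any `K`-algebra that is a field), the `L`-algebra `L ⊗_K D` is again simple (a standard
fact: two-sided ideals of `A ⊗_K D` are extended from `A` when `D` is central simple;
Farb–Dennis, *Noncommutative Algebra*, Ch. 3; Bourbaki, *Algèbre* VIII; Gille–Szamuely, Ch. 2).
The proof is the "sandwich" argument on top of the Azumaya property of `D` proved in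
`Literature.RingTheory.CentralSimple.MulLeftRight` (`bijective_sum_mulLeft_comp_mulRight`): every
`K`-linear endomorphism of `D`, in particular `y ↦ βʲ(y) · 1` for a basis `β` with dual basis `βʲ`,
is of the form `y ↦ Σᵢ aᵢ y βᵢ`; applying `Σᵢ (1 ⊗ aᵢ) · x · (1 ⊗ βᵢ)` to an element
`x = Σⱼ mⱼ ⊗ βⱼ` of a two-sided ideal `I` shows `mⱼ ⊗ 1 ∈ I` for every coefficient `mⱼ ∈ L`
(`tmul_one_repr_mem`); a non-zero `x` has a non-zero, hence invertible, coefficient, so `I = ⊤`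
(`isSimpleRing_tensorProduct`). Finite-dimensionality is spelled `Module.Finite` so that the
lemmas apply to type synonyms carrying only `Ring`/`Algebra` instances (e.g. `End⁰` of an abelian
variety).

## References

* B. Farb, R. K. Dennis, *Noncommutative Algebra*, GTM 144 (1993), Ch. 3 (the sandwich map,
  `A ⊗ Aᵒᵖ ≅ End_k(A)`, ideals of tensor products with central simple algebras).
* N. Bourbaki, *Algèbre*, Ch. VIII (2012). [BourbakiAlgebreVIII2012]
* P. Gille, T. Szamuely, *Central Simple Algebras and Galois Cohomology* (2006), Ch. 2.
  [GilleSzamuely2006]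
-/

namespace Literature.RingTheory.CentralSimple

open scoped TensorProduct

variable {K : Type*} [Field K] {D : Type*} [Ring D] [Algebra K D]
variable (L : Type*) [Field L] [Algebra K L]

/-- **Coefficients of an element of a two-sided ideal of `L ⊗_K D` lie in the ideal** (`D`
central simple, finite-dimensional over `K`): if `x = Σⱼ mⱼ ⊗ βⱼ ∈ I` for a `K`-basis `β` of `D`
(coordinates `mⱼ ∈ L` for the `L`-basis `1 ⊗ βⱼ` of `L ⊗_K D`), then `mⱼ ⊗ 1 ∈ I` for every `j`:
with `aᵢ ∈ D` such that `Σᵢ aᵢ y βᵢ = βʲ(y) · 1` for all `y` (Azumaya property,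
`bijective_sum_mulLeft_comp_mulRight`), `Σᵢ (1 ⊗ aᵢ) x (1 ⊗ βᵢ) = mⱼ ⊗ 1`. [folklore] -/
theorem tmul_one_repr_mem [Algebra.IsCentral K D] [IsSimpleRing D] [Module.Finite K D]
    {m : ℕ} (β : Module.Basis (Fin m) K D) (I : TwoSidedIdeal (L ⊗[K] D)) {x : L ⊗[K] D}
    (hx : x ∈ I) (j : Fin m) :
    ((Algebra.TensorProduct.basis L β).repr x j) ⊗ₜ[K] (1 : D) ∈ I := by
  classical
  haveI : FiniteDimensional K D := ‹Module.Finite K D›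
  -- the sandwich coefficients realising `y ↦ βʲ(y) · 1`
  obtain ⟨a, ha⟩ := (bijective_sum_mulLeft_comp_mulRight β).2
    ((LinearMap.smulRight (β.coord j) (1 : D)) : Module.End K D)
  have ha' : ∀ y : D, ∑ i, a i * y * β i = β.coord j y • (1 : D) := fun y ↦ by
    have := congrArg (fun T : Module.End K D ↦ T y) ha
    simpa only [LinearMap.coe_sum, Finset.sum_apply, LinearMap.comp_apply,
      LinearMap.mulRight_apply, LinearMap.mulLeft_apply, LinearMap.smulRight_apply,
      mul_assoc] using this
  -- the sandwiched element lies in `I`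
  set c := (Algebra.TensorProduct.basis L β).repr x with hc
  have hmem : ∑ i, (1 : L) ⊗ₜ[K] a i * x * ((1 : L) ⊗ₜ[K] β i) ∈ I :=
    sum_mem fun i _ ↦ I.mul_mem_right _ _ (I.mul_mem_left _ _ hx)
  -- and equals `c j ⊗ 1`
  have hx' : x = ∑ j', c j' ⊗ₜ[K] β j' := by
    conv_lhs => rw [← (Algebra.TensorProduct.basis L β).sum_repr x]
    refine Finset.sum_congr rfl fun j' _ ↦ ?_
    rw [Algebra.TensorProduct.basis_repr_symm_apply']
  have hcalc : ∑ i, (1 : L) ⊗ₜ[K] a i * x * ((1 : L) ⊗ₜ[K] β i) = c j ⊗ₜ[K] (1 : D) := by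
    calc ∑ i, (1 : L) ⊗ₜ[K] a i * x * ((1 : L) ⊗ₜ[K] β i)
        = ∑ i, ∑ j', c j' ⊗ₜ[K] (a i * β j' * β i) := by
          refine Finset.sum_congr rfl fun i _ ↦ ?_
          rw [hx', Finset.mul_sum, Finset.sum_mul]
          refine Finset.sum_congr rfl fun j' _ ↦ ?_
          rw [Algebra.TensorProduct.tmul_mul_tmul, Algebra.TensorProduct.tmul_mul_tmul, one_mul,
            mul_one]
      _ = ∑ j', c j' ⊗ₜ[K] (∑ i, a i * β j' * β i) := by
          rw [Finset.sum_comm]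
          refine Finset.sum_congr rfl fun j' _ ↦ ?_
          rw [TensorProduct.tmul_sum]
      _ = ∑ j', c j' ⊗ₜ[K] (β.coord j (β j') • (1 : D)) := by
          simp_rw [ha']
      _ = c j ⊗ₜ[K] (1 : D) := by
          rw [Finset.sum_eq_single j]
          · rw [Module.Basis.coord_apply, Module.Basis.repr_self, Finsupp.single_eq_same, one_smul]
          · intro j' _ hj'
            rw [Module.Basis.coord_apply, Module.Basis.repr_self, Finsupp.single_apply,
              if_neg hj', zero_smul, TensorProduct.tmul_zero]
          · intro h
            exact absurd (Finset.mem_univ j) h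
  rw [hcalc] at hmem
  exact hmem

/-- **`L ⊗_K D` is simple** for a finite-dimensional central simple `K`-algebra `D` and a field
`L` over `K` (Farb–Dennis, *Noncommutative Algebra*, Ch. 3; Bourbaki, *Algèbre* VIII): a
non-zero element `x` of a two-sided ideal `I` has a non-zero coordinate `mⱼ ∈ L` in the
`L`-basis `1 ⊗ βⱼ`, and `mⱼ ⊗ 1 ∈ I` (`tmul_one_repr_mem`) is invertible, so `I = ⊤`.
[folklore] -/
theorem isSimpleRing_tensorProduct [Algebra.IsCentral K D] [IsSimpleRing D]
    [Module.Finite K D] : IsSimpleRing (L ⊗[K] D) := by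
  classical
  let β := Module.finBasis K D
  let B := Algebra.TensorProduct.basis L β
  -- `L ⊗_K D` is non-trivial: `D ≠ 0`, so the `L`-basis `1 ⊗ βⱼ` is non-empty
  have hpos : 0 < Module.finrank K D := Module.finrank_pos
  haveI : Nontrivial (L ⊗[K] D) :=
    nontrivial_of_ne (B ⟨0, hpos⟩) 0 (B.ne_zero _)
  refine IsSimpleRing.of_eq_bot_or_eq_top fun I ↦ ?_
  by_cases hI : I = ⊥
  · exact Or.inl hI
  right
  -- a non-zero element of `I` and a non-zero coordinate of it
  obtain ⟨x, hxI, hx0⟩ : ∃ x ∈ I, x ≠ 0 := by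
    by_contra h
    push Not at h
    exact hI (eq_bot_iff.2 fun x hx ↦ (TwoSidedIdeal.mem_bot _).2 (h x hx))
  obtain ⟨j, hj⟩ : ∃ j, B.repr x j ≠ 0 := by
    by_contra h
    push Not at h
    exact hx0 (B.repr.injective (Finsupp.ext fun j ↦ by rw [h j, map_zero, Finsupp.zero_apply]))
  -- `mⱼ ⊗ 1 ∈ I` is invertible
  have hmem := tmul_one_repr_mem L β I hxI j
  rw [← TwoSidedIdeal.one_mem_iff]
  have h1 : (1 : L ⊗[K] D) = ((B.repr x j)⁻¹ ⊗ₜ[K] (1 : D)) * (B.repr x j ⊗ₜ[K] (1 : D)) := by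
    rw [Algebra.TensorProduct.tmul_mul_tmul, inv_mul_cancel₀ hj, mul_one]
    rfl
  rw [h1]
  exact I.mul_mem_left _ _ hmem

end Literature.RingTheory.CentralSimple
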